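import Mathlib
import HarnessLib
import Summits.HubbardSuperconductivity.HubbardSuperconductivity.Theorems.KLProgrammeC4aCausticWindowCover
import Summits.HubbardSuperconductivity.HubbardSuperconductivity.Theorems.KLProgrammeC4aCausticWindowCoverFree
import Summits.HubbardSuperconductivity.HubbardSuperconductivity.Theorems.KLProgrammeC4aFoldBoxModulus

/-!
# Route `KLProgramme` — crux C4a, S3 brick (B4) «(U1)-LAWS» part 10: the FOLD-BOX HYPOTHESES ALONG A ϑ-TILE FROM THE NEAR-CAUSTIC WITNESS — uniformly in the tube
# angle `ϑ ∈ [α,β]`, the package hypotheses of parts 4a/4b/5d for the configuration `S(ϑ)` follow from the witness and the tile-level thresholds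

Cell `gate-hubbard-kl`, seat hubbard-kl-k3c3-p3 (g31; row «implicit-function / monotonicity route for μ(n)»).  Located brick for the (C)-closer lane / the (M4)
assembly of the umklapp first-order ϑ-layer (stub (C) `stub_twoLeg_curvature` of `KLRegimeEngineV17F2`, stmt-HubbardSuperconductivity-20437), memo
HOME/hubbard-kl-k3c3-p3/U1-CAUSTIC-SUP.md §11.

WHY.  The cover theorem (`…C4aCausticWindowCoverLog.intervalIntegral_caustic_nearCaustic_umklapp_log_le`) asks its three laws at EVERY `ϑ` of the tile; parts 4a/4b/5d
deliver them for the configuration `S = S(ϑ) := Φ(0,θ) + Φ(ρ,ϑ+θ)` under the fold-box package hypotheses keyed to `dist₀(ϑ) = ‖S(ϑ) − 2πm − 2Φ(0,x₀+θ)‖`.  With the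
reference loop angle `x₀ := φ₁` (the witness's) the datum is uniformly small on the tile: `dist₀(ϑ) ≤ τ₀ + msD₁|ϑ − ϑ₁| ≤ τ₀ + msD₁(β − α) =: d̄` (p673633 §2), and every
package hypothesis is monotone in the datum.  So ONE set of tile-level inequalities in `d̄` gives the package at every `ϑ`:
* `sInf_sheetBase_eq` (the cover theorem's offset `inf_φ e_K(c + Φ(ρ,ϑ+θ) − Φ(0,φ+θ))`, `c = Φ(0,θ) − 2πm`, IS parts 4a/4b/5d's `inf_φ e_K(S(ϑ) − Φ(0,φ+θ))`);
* `norm_caustic_along_tile_le` (`dist₀(ϑ) ≤ d̄`); `foldBox_modulus_mono_dist` (the modulus is monotone in the datum too);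
* **`foldBox_hyps_along_tile`** (HEADLINE): witness `(ϑ₁,φ₁)` in `[α,β] × [φa,φb]` with `‖c + Φ(ρ,ϑ₁+θ) − 2Φ(0,φ₁+θ)‖ ≤ τ₀`, loop window of length `≤ Wφ`, and the
  tile-level thresholds — modulus at (`d̄`, `hi`, `Wφ`) `≤ w·u_min²`, `K₂msD₁(d̄ + 2hi/(Dt−2A)) ≤ w·u_min²·W_m`, `K₂(d̄ + 2(hi/(Dt−2A) + msD₁Wφ))/(Dt−2A) ≤ 1/2` ⟹ for EVERY
  `ϑ ∈ [α,β]`: the pointwise `hwin`, `hslope`, `hrate` of `…C4aFoldBoxPartnerBandLaws.partnerBand_foldBox_package` for `S(ϑ)` with `x₀ = φ₁`, and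
  `dist₀(ϑ) + 2msD₁Wφ ≤ d̄ + 2msD₁Wφ` (the caustic budget `hΔ` of part 5d with `Δ := d̄ + 2msD₁Wφ`).  With p681871's feasible sizes (`d̄, hi ≤ t`) all four hold.
Sizes binder shape; bookkeeping on landed lemmas; nothing asserts (C), K3 or superconductivity.  References: BGM 2003 §7.1 [cite: BenfattoGiulianiMastropietro2003].
-/

noncomputable section

namespace Summit.HubbardSuperconductivity.HubbardSuperconductivity.Theorems.C4a

set_option linter.dupNamespace false -- summit = problem name (single-conjunct summit), D-0017

open Real Set
open Literature.MathematicalPhysics.QuantumLattice Literature.MathematicalPhysics.QuantumLattice.BandSectorCounting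
open Literature.MathematicalPhysics.QuantumLattice.FermiRG
open Summit.HubbardSuperconductivity.HubbardSuperconductivity.Theorems.KLRegimeSplit
open Summit.HubbardSuperconductivity.HubbardSuperconductivity.Theorems.DispersionFlow
open Summit.HubbardSuperconductivity.HubbardSuperconductivity.Theorems.PerturbedFermiCurve

/-- **The cover theorem's offset is the fold-box offset**: for the sheet base `c = Φ(0,θ) − 2πm`,
`inf_{φ ∈ [φa,φb]} e_K(c + Φ(ρ,ϑ+θ) − Φ(0,φ+θ)) = inf_{φ ∈ [φa,φb]} e_K(S(ϑ) − Φ(0,φ+θ))`, `S(ϑ) = pairSumPath μ K ρ ϑ θ 0`. -/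
theorem sInf_sheetBase_eq (μ : ℝ) (K : TrigPolyC4v) (ρ ϑ θ φa φb : ℝ) (m : Fin 2 → ℤ) :
    sInf ((fun φ => frameLevel μ K (levelPoint μ K 0 θ - WithLp.toLp 2 (fun i => 2 * π * (m i : ℝ)) + (levelPoint μ K ρ (ϑ + θ) - levelPoint μ K 0 (φ + θ)))) ''
        Icc φa φb) =
      sInf ((fun φ => frameLevel μ K (pairSumPath μ K ρ ϑ θ 0 - levelPoint μ K 0 (φ + θ))) '' Icc φa φb) := by
  have hfun : (fun φ => frameLevel μ K (levelPoint μ K 0 θ - WithLp.toLp 2 (fun i => 2 * π * (m i : ℝ)) + (levelPoint μ K ρ (ϑ + θ) - levelPoint μ K 0 (φ + θ)))) =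
      fun φ => frameLevel μ K (pairSumPath μ K ρ ϑ θ 0 - levelPoint μ K 0 (φ + θ)) := funext fun φ => frameLevel_sheetBase_eq μ K ρ ϑ θ φ m
  rw [hfun]

/-- The sheet-base form of the caustic datum: `c + Φ(ρ,ϑ+θ) − Φ(0,φ+θ) − Φ(0,φ+θ) = S(ϑ) − 2πm − 2Φ(0,φ+θ)`. -/
theorem sheetBase_config_eq (μ : ℝ) (K : TrigPolyC4v) (ρ ϑ θ φ : ℝ) (m : Fin 2 → ℤ) :
    levelPoint μ K 0 θ - WithLp.toLp 2 (fun i => 2 * π * (m i : ℝ)) + (levelPoint μ K ρ (ϑ + θ) - levelPoint μ K 0 (φ + θ)) - levelPoint μ K 0 (φ + θ) =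
      pairSumPath μ K ρ ϑ θ 0 - WithLp.toLp 2 (fun i => 2 * π * (m i : ℝ)) - (2 : ℝ) • levelPoint μ K 0 (φ + θ) := by
  simp only [pairSumPath, add_zero, two_smul]; abel

section Sizes

variable {K : TrigPolyC4v} {A : ℝ} (hA : ∀ p : Momentum, ∀ j ≤ 2, ‖iteratedFDeriv ℝ j (frameShift K) p‖ ≤ A) (hA20 : A ≤ 1 / 20)
  (hd : klCurveD ≤ (bandBounds (show (-4 : ℝ) < -1.1 by norm_num) (show (-1.1 : ℝ) ≤ -0.1 by norm_num)
    (show (-0.1 : ℝ) < 0 by norm_num)).Dtmin - 2 * A)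
  {μ r : ℝ} (hr : 0 < r) (hlo : (-1.1 : ℝ) < μ - r - A) (hhi : μ + r + A < -0.1)
  {A₃ A₄ : ℝ} (hA₃ : ∀ p : Momentum, ‖iteratedFDeriv ℝ 3 (frameShift K) p‖ ≤ A₃)
  (hA₄ : ∀ p : Momentum, ‖iteratedFDeriv ℝ 4 (frameShift K) p‖ ≤ A₄)
  {K₁ K₂ K₃ : ℝ} (hK₁ : ∀ p : Momentum, ‖fderiv ℝ (frameLevel μ K) p‖ ≤ K₁) (hK₂ : ∀ p : Momentum, ‖iteratedFDeriv ℝ 2 (frameLevel μ K) p‖ ≤ K₂)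
  (hK₃ : ∀ p : Momentum, ‖iteratedFDeriv ℝ 3 (frameLevel μ K) p‖ ≤ K₃)
include hA hA20 hd hr hlo hhi hA₃ hA₄ hK₁ hK₂ hK₃

omit hr hK₁ hK₂ hK₃ in
/-- **The caustic datum along the tile**: a witness `(ϑ₁, φ₁)` with `‖c + Φ(ρ,ϑ₁+θ) − 2Φ(0,φ₁+θ)‖ ≤ τ₀`, `ϑ₁ ∈ [α,β]` ⟹ for every `ϑ ∈ [α,β]`,
`‖S(ϑ) − 2πm − 2Φ(0,φ₁+θ)‖ ≤ τ₀ + msD₁(β − α)`. -/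
theorem norm_caustic_along_tile_le {ρ : ℝ} (hρ : |ρ| < r) (θ : ℝ) (m : Fin 2 → ℤ) {α β ϑ₁ φ₁ τ₀ : ℝ} (hϑ₁ : ϑ₁ ∈ Icc α β)
    (hτ : ‖levelPoint μ K 0 θ - WithLp.toLp 2 (fun i => 2 * π * (m i : ℝ)) + (levelPoint μ K ρ (ϑ₁ + θ) - levelPoint μ K 0 (φ₁ + θ)) -
      levelPoint μ K 0 (φ₁ + θ)‖ ≤ τ₀) {ϑ : ℝ} (hϑ : ϑ ∈ Icc α β) :
    ‖pairSumPath μ K ρ ϑ θ 0 - WithLp.toLp 2 (fun i => 2 * π * (m i : ℝ)) - (2 : ℝ) • levelPoint μ K 0 (φ₁ + θ)‖ ≤ τ₀ + msD A₃ A₄ 1 * (β - α) := by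
  have h := norm_partnerBand_sub_loopPoint_le_of_nearCaustic hA hA20 hd hlo hhi hA₃ hA₄ hρ
    (levelPoint μ K 0 θ - WithLp.toLp 2 (fun i => 2 * π * (m i : ℝ))) θ hτ ϑ φ₁
  rw [sheetBase_config_eq, sub_self, abs_zero, mul_zero, add_zero] at h
  have hM : 0 ≤ msD A₃ A₄ 1 := (norm_nonneg _).trans (norm_iteratedDeriv_levelPoint_le hA hA20 hd hlo hhi hA₃ hA₄ hρ le_rfl (by norm_num) 0)
  have h1 : |ϑ - ϑ₁| ≤ β - α := abs_sub_le_iff.2 ⟨by linarith [hϑ.2, hϑ₁.1], by linarith [hϑ.1, hϑ₁.2]⟩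
  have := mul_le_mul_of_nonneg_left h1 hM
  linarith

omit hA hA20 hd hr hlo hhi hA₃ hA₄ hK₁ in
/-- **The modulus is monotone in the caustic datum**: `dist ≤ dist′` ⟹ modulus(dist, hi, Wφ) ≤ modulus(dist′, hi, Wφ). -/
theorem foldBox_modulus_mono_dist {dist dist' hi Wφ : ℝ} (hdist : dist ≤ dist') :
    K₃ * (dist + hi / ((bandBounds (show (-4 : ℝ) < -1.1 by norm_num) (show (-1.1 : ℝ) ≤ -0.1 by norm_num) (show (-0.1 : ℝ) < 0 by norm_num)).Dtmin - 2 * A) +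
            msD A₃ A₄ 1 * Wφ) * msD A₃ A₄ 1 ^ 2 +
        K₂ * (radialRowOneConst A ((bandBounds (show (-4 : ℝ) < -1.1 by norm_num) (show (-1.1 : ℝ) ≤ -0.1 by norm_num) (show (-0.1 : ℝ) < 0 by norm_num)).Dtmin -
              2 * A) * hi + msD A₃ A₄ 2 * Wφ) * (msD A₃ A₄ 1 + msD A₃ A₄ 1) +
        K₂ * (dist + hi / ((bandBounds (show (-4 : ℝ) < -1.1 by norm_num) (show (-1.1 : ℝ) ≤ -0.1 by norm_num) (show (-0.1 : ℝ) < 0 by norm_num)).Dtmin - 2 * A) +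
            msD A₃ A₄ 1 * Wφ) * msD A₃ A₄ 2 +
        K₁ * ((uRowTwoConst A A₃ ((bandBounds (show (-4 : ℝ) < -1.1 by norm_num) (show (-1.1 : ℝ) ≤ -0.1 by norm_num) (show (-0.1 : ℝ) < 0 by norm_num)).Dtmin -
                2 * A) +
              1 / ((bandBounds (show (-4 : ℝ) < -1.1 by norm_num) (show (-1.1 : ℝ) ≤ -0.1 by norm_num) (show (-0.1 : ℝ) < 0 by norm_num)).Dtmin - 2 * A) +
              2 * (radialRowOneConst A ((bandBounds (show (-4 : ℝ) < -1.1 by norm_num) (show (-1.1 : ℝ) ≤ -0.1 by norm_num)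
                  (show (-0.1 : ℝ) < 0 by norm_num)).Dtmin - 2 * A) -
                1 / ((bandBounds (show (-4 : ℝ) < -1.1 by norm_num) (show (-1.1 : ℝ) ≤ -0.1 by norm_num) (show (-0.1 : ℝ) < 0 by norm_num)).Dtmin - 2 * A))) *
            hi + msD A₃ A₄ 3 * Wφ) ≤
      K₃ * (dist' + hi / ((bandBounds (show (-4 : ℝ) < -1.1 by norm_num) (show (-1.1 : ℝ) ≤ -0.1 by norm_num) (show (-0.1 : ℝ) < 0 by norm_num)).Dtmin - 2 * A) +
            msD A₃ A₄ 1 * Wφ) * msD A₃ A₄ 1 ^ 2 +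
        K₂ * (radialRowOneConst A ((bandBounds (show (-4 : ℝ) < -1.1 by norm_num) (show (-1.1 : ℝ) ≤ -0.1 by norm_num) (show (-0.1 : ℝ) < 0 by norm_num)).Dtmin -
              2 * A) * hi + msD A₃ A₄ 2 * Wφ) * (msD A₃ A₄ 1 + msD A₃ A₄ 1) +
        K₂ * (dist' + hi / ((bandBounds (show (-4 : ℝ) < -1.1 by norm_num) (show (-1.1 : ℝ) ≤ -0.1 by norm_num) (show (-0.1 : ℝ) < 0 by norm_num)).Dtmin - 2 * A) +
            msD A₃ A₄ 1 * Wφ) * msD A₃ A₄ 2 +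
        K₁ * ((uRowTwoConst A A₃ ((bandBounds (show (-4 : ℝ) < -1.1 by norm_num) (show (-1.1 : ℝ) ≤ -0.1 by norm_num) (show (-0.1 : ℝ) < 0 by norm_num)).Dtmin -
                2 * A) +
              1 / ((bandBounds (show (-4 : ℝ) < -1.1 by norm_num) (show (-1.1 : ℝ) ≤ -0.1 by norm_num) (show (-0.1 : ℝ) < 0 by norm_num)).Dtmin - 2 * A) +
              2 * (radialRowOneConst A ((bandBounds (show (-4 : ℝ) < -1.1 by norm_num) (show (-1.1 : ℝ) ≤ -0.1 by norm_num)
                  (show (-0.1 : ℝ) < 0 by norm_num)).Dtmin - 2 * A) -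
                1 / ((bandBounds (show (-4 : ℝ) < -1.1 by norm_num) (show (-1.1 : ℝ) ≤ -0.1 by norm_num) (show (-0.1 : ℝ) < 0 by norm_num)).Dtmin - 2 * A))) *
            hi + msD A₃ A₄ 3 * Wφ) := by
  have hK₂0 : 0 ≤ K₂ := (norm_nonneg _).trans (hK₂ 0)
  have hK₃0 : 0 ≤ K₃ := (norm_nonneg _).trans (hK₃ 0)
  have hD₁ : 0 ≤ msD A₃ A₄ 1 := (msD_one_pos A₃ A₄).le
  have hD₂ : 0 ≤ msD A₃ A₄ 2 := (msD_two_pos A₃ A₄).le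
  gcongr

omit hr in
/-- **THE FOLD-BOX HYPOTHESES ALONG A ϑ-TILE** (HEADLINE; see the module docstring).  For every `ϑ ∈ [α,β]`, with `S(ϑ) = pairSumPath μ K ρ ϑ θ 0`,
`v = 2πm` and `x₀ = φ₁`: the pointwise window hypothesis, the slope budget, the rate window, and `dist₀(ϑ) + 2msD₁Wφ ≤ d̄ + 2msD₁Wφ`, `d̄ = τ₀ + msD₁(β − α)`. -/
theorem foldBox_hyps_along_tile {ρ : ℝ} (hρ : |ρ| < r) (θ : ℝ) (m : Fin 2 → ℤ) {α β φa φb ϑ₁ φ₁ τ₀ hi Wφ Wm w : ℝ}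
    (hϑ₁ : ϑ₁ ∈ Icc α β) (hφ₁ : φ₁ ∈ Icc φa φb)
    (hτ : ‖levelPoint μ K 0 θ - WithLp.toLp 2 (fun i => 2 * π * (m i : ℝ)) + (levelPoint μ K ρ (ϑ₁ + θ) - levelPoint μ K 0 (φ₁ + θ)) -
      levelPoint μ K 0 (φ₁ + θ)‖ ≤ τ₀)
    (hWφ : φb - φa ≤ Wφ)
    (hmod : K₃ * (τ₀ + msD A₃ A₄ 1 * (β - α) +
              hi / ((bandBounds (show (-4 : ℝ) < -1.1 by norm_num) (show (-1.1 : ℝ) ≤ -0.1 by norm_num) (show (-0.1 : ℝ) < 0 by norm_num)).Dtmin - 2 * A) +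
              msD A₃ A₄ 1 * Wφ) * msD A₃ A₄ 1 ^ 2 +
          K₂ * (radialRowOneConst A ((bandBounds (show (-4 : ℝ) < -1.1 by norm_num) (show (-1.1 : ℝ) ≤ -0.1 by norm_num) (show (-0.1 : ℝ) < 0 by norm_num)).Dtmin -
                2 * A) * hi + msD A₃ A₄ 2 * Wφ) * (msD A₃ A₄ 1 + msD A₃ A₄ 1) +
          K₂ * (τ₀ + msD A₃ A₄ 1 * (β - α) +
              hi / ((bandBounds (show (-4 : ℝ) < -1.1 by norm_num) (show (-1.1 : ℝ) ≤ -0.1 by norm_num) (show (-0.1 : ℝ) < 0 by norm_num)).Dtmin - 2 * A) +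
              msD A₃ A₄ 1 * Wφ) * msD A₃ A₄ 2 +
          K₁ * ((uRowTwoConst A A₃ ((bandBounds (show (-4 : ℝ) < -1.1 by norm_num) (show (-1.1 : ℝ) ≤ -0.1 by norm_num) (show (-0.1 : ℝ) < 0 by norm_num)).Dtmin -
                  2 * A) +
                1 / ((bandBounds (show (-4 : ℝ) < -1.1 by norm_num) (show (-1.1 : ℝ) ≤ -0.1 by norm_num) (show (-0.1 : ℝ) < 0 by norm_num)).Dtmin - 2 * A) +
                2 * (radialRowOneConst A ((bandBounds (show (-4 : ℝ) < -1.1 by norm_num) (show (-1.1 : ℝ) ≤ -0.1 by norm_num)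
                    (show (-0.1 : ℝ) < 0 by norm_num)).Dtmin - 2 * A) -
                  1 / ((bandBounds (show (-4 : ℝ) < -1.1 by norm_num) (show (-1.1 : ℝ) ≤ -0.1 by norm_num) (show (-0.1 : ℝ) < 0 by norm_num)).Dtmin - 2 * A))) *
              hi + msD A₃ A₄ 3 * Wφ) ≤
        w * (bandBounds (show (-4 : ℝ) < -1.1 by norm_num) (show (-1.1 : ℝ) ≤ -0.1 by norm_num) (show (-0.1 : ℝ) < 0 by norm_num)).umin ^ 2)
    (hsl : K₂ * msD A₃ A₄ 1 * (τ₀ + msD A₃ A₄ 1 * (β - α) +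
        2 * (hi / ((bandBounds (show (-4 : ℝ) < -1.1 by norm_num) (show (-1.1 : ℝ) ≤ -0.1 by norm_num) (show (-0.1 : ℝ) < 0 by norm_num)).Dtmin - 2 * A))) ≤
      w * (bandBounds (show (-4 : ℝ) < -1.1 by norm_num) (show (-1.1 : ℝ) ≤ -0.1 by norm_num) (show (-0.1 : ℝ) < 0 by norm_num)).umin ^ 2 * Wm)
    (hrt : K₂ * (τ₀ + msD A₃ A₄ 1 * (β - α) +
          2 * (hi / ((bandBounds (show (-4 : ℝ) < -1.1 by norm_num) (show (-1.1 : ℝ) ≤ -0.1 by norm_num) (show (-0.1 : ℝ) < 0 by norm_num)).Dtmin - 2 * A) +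
            msD A₃ A₄ 1 * Wφ)) /
        ((bandBounds (show (-4 : ℝ) < -1.1 by norm_num) (show (-1.1 : ℝ) ≤ -0.1 by norm_num) (show (-0.1 : ℝ) < 0 by norm_num)).Dtmin - 2 * A) ≤ 1 / 2)
    {ϑ : ℝ} (hϑ : ϑ ∈ Icc α β) :
    (∀ e ∈ Icc (-hi) hi, ∀ y ∈ Icc φa φb,
      K₃ * (‖pairSumPath μ K ρ ϑ θ 0 - WithLp.toLp 2 (fun i => 2 * π * (m i : ℝ)) - (levelPoint μ K 0 (φ₁ + θ) + levelPoint μ K 0 (φ₁ + θ))‖ +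
              |e| / ((bandBounds (show (-4 : ℝ) < -1.1 by norm_num) (show (-1.1 : ℝ) ≤ -0.1 by norm_num) (show (-0.1 : ℝ) < 0 by norm_num)).Dtmin - 2 * A) +
              msD A₃ A₄ 1 * |y - φ₁|) * msD A₃ A₄ 1 ^ 2 +
          K₂ * (radialRowOneConst A ((bandBounds (show (-4 : ℝ) < -1.1 by norm_num) (show (-1.1 : ℝ) ≤ -0.1 by norm_num) (show (-0.1 : ℝ) < 0 by norm_num)).Dtmin -
                2 * A) * |e| + msD A₃ A₄ 2 * |y - φ₁|) * (msD A₃ A₄ 1 + msD A₃ A₄ 1) +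
          K₂ * (‖pairSumPath μ K ρ ϑ θ 0 - WithLp.toLp 2 (fun i => 2 * π * (m i : ℝ)) - (levelPoint μ K 0 (φ₁ + θ) + levelPoint μ K 0 (φ₁ + θ))‖ +
              |e| / ((bandBounds (show (-4 : ℝ) < -1.1 by norm_num) (show (-1.1 : ℝ) ≤ -0.1 by norm_num) (show (-0.1 : ℝ) < 0 by norm_num)).Dtmin - 2 * A) +
              msD A₃ A₄ 1 * |y - φ₁|) * msD A₃ A₄ 2 +
          K₁ * ((uRowTwoConst A A₃ ((bandBounds (show (-4 : ℝ) < -1.1 by norm_num) (show (-1.1 : ℝ) ≤ -0.1 by norm_num) (show (-0.1 : ℝ) < 0 by norm_num)).Dtmin -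
                  2 * A) +
                1 / ((bandBounds (show (-4 : ℝ) < -1.1 by norm_num) (show (-1.1 : ℝ) ≤ -0.1 by norm_num) (show (-0.1 : ℝ) < 0 by norm_num)).Dtmin - 2 * A) +
                2 * (radialRowOneConst A ((bandBounds (show (-4 : ℝ) < -1.1 by norm_num) (show (-1.1 : ℝ) ≤ -0.1 by norm_num)
                    (show (-0.1 : ℝ) < 0 by norm_num)).Dtmin - 2 * A) -
                  1 / ((bandBounds (show (-4 : ℝ) < -1.1 by norm_num) (show (-1.1 : ℝ) ≤ -0.1 by norm_num) (show (-0.1 : ℝ) < 0 by norm_num)).Dtmin - 2 * A))) *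
              |e| + msD A₃ A₄ 3 * |y - φ₁|) ≤
        w * (bandBounds (show (-4 : ℝ) < -1.1 by norm_num) (show (-1.1 : ℝ) ≤ -0.1 by norm_num) (show (-0.1 : ℝ) < 0 by norm_num)).umin ^ 2) ∧
    K₂ * msD A₃ A₄ 1 * (‖pairSumPath μ K ρ ϑ θ 0 - WithLp.toLp 2 (fun i => 2 * π * (m i : ℝ)) - (2 : ℝ) • levelPoint μ K 0 (φ₁ + θ)‖ +
        2 * (hi / ((bandBounds (show (-4 : ℝ) < -1.1 by norm_num) (show (-1.1 : ℝ) ≤ -0.1 by norm_num) (show (-0.1 : ℝ) < 0 by norm_num)).Dtmin - 2 * A))) ≤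
      w * (bandBounds (show (-4 : ℝ) < -1.1 by norm_num) (show (-1.1 : ℝ) ≤ -0.1 by norm_num) (show (-0.1 : ℝ) < 0 by norm_num)).umin ^ 2 * Wm ∧
    K₂ * (‖pairSumPath μ K ρ ϑ θ 0 - WithLp.toLp 2 (fun i => 2 * π * (m i : ℝ)) - (2 : ℝ) • levelPoint μ K 0 (φ₁ + θ)‖ +
          2 * (hi / ((bandBounds (show (-4 : ℝ) < -1.1 by norm_num) (show (-1.1 : ℝ) ≤ -0.1 by norm_num) (show (-0.1 : ℝ) < 0 by norm_num)).Dtmin - 2 * A) +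
            msD A₃ A₄ 1 * Wφ)) /
        ((bandBounds (show (-4 : ℝ) < -1.1 by norm_num) (show (-1.1 : ℝ) ≤ -0.1 by norm_num) (show (-0.1 : ℝ) < 0 by norm_num)).Dtmin - 2 * A) ≤ 1 / 2 ∧
    ‖pairSumPath μ K ρ ϑ θ 0 - WithLp.toLp 2 (fun i => 2 * π * (m i : ℝ)) - (2 : ℝ) • levelPoint μ K 0 (φ₁ + θ)‖ + 2 * (msD A₃ A₄ 1 * Wφ) ≤
      τ₀ + msD A₃ A₄ 1 * (β - α) + 2 * (msD A₃ A₄ 1 * Wφ) := by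
  set B := bandBounds (show (-4 : ℝ) < -1.1 by norm_num) (show (-1.1 : ℝ) ≤ -0.1 by norm_num) (show (-0.1 : ℝ) < 0 by norm_num) with hBdef
  have hADt : 2 * A < B.Dtmin := by have := klCurveD_pos; linarith
  have hDt : 0 < B.Dtmin - 2 * A := by linarith
  have hK₂0 : 0 ≤ K₂ := (norm_nonneg _).trans (hK₂ 0)
  have hD₁ : 0 ≤ msD A₃ A₄ 1 := (msD_one_pos A₃ A₄).le
  have hr' : 0 < r := lt_of_le_of_lt (abs_nonneg ρ) hρ
  -- the datum along the tile
  have hdist := norm_caustic_along_tile_le hA hA20 hd hlo hhi hA₃ hA₄ hρ θ m hϑ₁ hτ hϑ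
  have hdist' : ‖pairSumPath μ K ρ ϑ θ 0 - WithLp.toLp 2 (fun i => 2 * π * (m i : ℝ)) - (levelPoint μ K 0 (φ₁ + θ) + levelPoint μ K 0 (φ₁ + θ))‖ ≤
      τ₀ + msD A₃ A₄ 1 * (β - α) := by rw [← two_smul ℝ]; exact hdist
  have hWφ' : ∀ y ∈ Icc φa φb, |y - φ₁| ≤ Wφ := fun y hy =>
    (abs_sub_le_iff.2 ⟨by linarith [hy.2, hφ₁.1], by linarith [hy.1, hφ₁.2]⟩ : |y - φ₁| ≤ φb - φa).trans hWφ
  refine ⟨?_, ?_, ?_, by linarith⟩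
  · -- window hypothesis: monotone in the datum, then in (e, y)
    have hmod' := (foldBox_modulus_mono_dist hK₂ hK₃ (hi := hi) (Wφ := Wφ) hdist').trans hmod
    exact foldBox_hwin_of_le hA hA20 hd hr' hlo hhi hA₃ hA₄ hK₁ hK₂ hK₃ hWφ' hmod'
  · -- slope budget
    have : K₂ * msD A₃ A₄ 1 * (‖pairSumPath μ K ρ ϑ θ 0 - WithLp.toLp 2 (fun i => 2 * π * (m i : ℝ)) - (2 : ℝ) • levelPoint μ K 0 (φ₁ + θ)‖ +
        2 * (hi / (B.Dtmin - 2 * A))) ≤ K₂ * msD A₃ A₄ 1 * (τ₀ + msD A₃ A₄ 1 * (β - α) + 2 * (hi / (B.Dtmin - 2 * A))) :=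
      mul_le_mul_of_nonneg_left (by linarith) (by positivity)
    exact this.trans hsl
  · -- rate window
    have : K₂ * (‖pairSumPath μ K ρ ϑ θ 0 - WithLp.toLp 2 (fun i => 2 * π * (m i : ℝ)) - (2 : ℝ) • levelPoint μ K 0 (φ₁ + θ)‖ +
        2 * (hi / (B.Dtmin - 2 * A) + msD A₃ A₄ 1 * Wφ)) / (B.Dtmin - 2 * A) ≤
        K₂ * (τ₀ + msD A₃ A₄ 1 * (β - α) + 2 * (hi / (B.Dtmin - 2 * A) + msD A₃ A₄ 1 * Wφ)) / (B.Dtmin - 2 * A) :=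
      div_le_div_of_nonneg_right (mul_le_mul_of_nonneg_left (by linarith) hK₂0) hDt.le
    exact this.trans hrt

end Sizes

end Summit.HubbardSuperconductivity.HubbardSuperconductivity.Theorems.C4a

end
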